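import Mathlib
import Summits.Ventures.HodgeRepro2.Tier7.Line3.UnitaryOneOneCentre
import Summits.Ventures.HodgeRepro2.Tier7.Line3.TorusCircleReduction

/-!
# Tier7/Line3/TorusMatrixLink — the model torus `Circle × Circle` as diagonal matrices of `U(1,1)`, and the centre
reduction for functions of the matrix (seat t7-x1, gen 2; row U1 of the t7-lead's RESIDUAL MAP, the link between
`UnitaryOneOneCentre` (matrices) and `TorusCircleReduction` (the torus integral))

`diagMat (α, β) = diag(α, β)` realises the torus `T = Circle × Circle` inside `U(1,1)` (`isU11_diagMat`,
`diagMat_mul`); the central part `diagZ = {(c, c)}` acts by the scalars (`diagMat_diagZ_mul`: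
`diagMat ((c, c) · k) = c • diagMat k`) and the `SU(1,1)`-part `antiK = {(u, u⁻¹)}` lands in `SU(1,1)`
(`isSU11_diagMat_antiK`). Hence a function `Φ` of the matrix that is invariant under unit scalars (the central
characters match: `Φ (c • M) = Φ M` for `‖c‖ = 1`) gives a `Z`-invariant function `Φ ∘ diagMat` on the torus, and
**`integral_eq_integral_antiK_matrix`**: `∫_T Φ (diagMat t) = ∫_K Φ (diagMat k)` with Haar probability measures —
row U1's «the bi-torus orbital integral over the real torus is the integral over the `SU(1,1)`-torus» for the model
torus, with the centre's action typed as the scalar action on matrices.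
Instance hypotheses as in `TorusCircleReduction` (`[MeasurableSpace Circle] [BorelSpace Circle]
[SecondCountableTopology Circle]`; no instance declared). Nothing about (N) or HC_CM; §8(d): NO.
Blind lane: Mathlib + the HodgeRepro2 prefix only; no sorry; axioms ⊆ {propext, Classical.choice, Quot.sound}.
-/

namespace Summit.Ventures.HodgeRepro2.Tier7.Line3.TorusMatrixLink

open Matrix MeasureTheory
open Summit.Ventures.HodgeRepro2.Tier7.Line3.UnitaryOneOneCentre
open Summit.Ventures.HodgeRepro2.Tier7.Line3.TorusCircleReduction

/-- the torus as diagonal matrices: `(α, β) ↦ diag(α, β)` -/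
noncomputable def diagMat (p : Circle × Circle) : Matrix (Fin 2) (Fin 2) ℂ :=
  diagonal ![(p.1 : ℂ), (p.2 : ℂ)]

/-- the torus lies in `U(1,1)`. -/
theorem isU11_diagMat (p : Circle × Circle) : IsU11 (diagMat p) :=
  isU11_diagonal (Circle.norm_coe p.1) (Circle.norm_coe p.2)

/-- `diagMat` is multiplicative. -/
theorem diagMat_mul (p q : Circle × Circle) : diagMat (p * q) = diagMat p * diagMat q := by
  unfold diagMat
  rw [diagonal_mul_diagonal]
  congr 1
  funext i
  fin_cases i <;> simp

/-- `diagMat` is continuous. -/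
theorem continuous_diagMat : Continuous diagMat := by
  unfold diagMat
  refine continuous_matrix fun i j => ?_
  simp only [diagonal_apply]
  refine continuous_if_const _ (fun _ => ?_) (fun _ => continuous_const)
  fin_cases i
  · exact continuous_subtype_val.comp continuous_fst
  · exact continuous_subtype_val.comp continuous_snd

/-- **the centre acts by scalars**: `diagMat ((c, c) · k) = c • diagMat k`. -/
theorem diagMat_diagZ_mul (c : Circle) (k : Circle × Circle) :
    diagMat ((c, c) * k) = (c : ℂ) • diagMat k := by
  unfold diagMat
  rw [Prod.mk_mul_mk, ← diagonal_smul]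
  congr 1
  funext i
  fin_cases i <;> simp

/-- the `SU(1,1)`-part of the torus lands in `SU(1,1)`. -/
theorem isSU11_diagMat_antiK (u : Circle) : IsSU11 (diagMat (u, u⁻¹)) := by
  have h := isSU11_diagonal_inv (Circle.norm_coe u)
  unfold diagMat
  simpa [Circle.coe_inv] using h

/-- a function of the matrix invariant under unit scalars gives a `Z`-invariant function of the torus. -/
theorem invariant_of_matrix (Φ : Matrix (Fin 2) (Fin 2) ℂ → ℂ)
    (hΦ : ∀ (c : ℂ) (M : Matrix (Fin 2) (Fin 2) ℂ), ‖c‖ = 1 → Φ (c • M) = Φ M) :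
    ∀ c u : Circle, Φ (diagMat (c * u, c * u⁻¹)) = Φ (diagMat (u, u⁻¹)) := by
  intro c u
  have e : ((c * u, c * u⁻¹) : Circle × Circle) = (c, c) * (u, u⁻¹) := by
    rw [Prod.mk_mul_mk]
  rw [e, diagMat_diagZ_mul]
  exact hΦ _ _ (Circle.norm_coe c)

/-- **ROW U1 for functions of the matrix**: for `Φ` continuous on `2 × 2` matrices and invariant under unit scalars
(the central characters match), the integral over the torus of `Φ ∘ diagMat` is its integral over the `SU(1,1)`-torus
`antiK`, with Haar probability measures. -/
theorem integral_eq_integral_antiK_matrix [MeasurableSpace Circle] [BorelSpace Circle]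
    [SecondCountableTopology Circle]
    (ν : Measure (Circle × Circle)) [ν.IsHaarMeasure] [IsProbabilityMeasure ν]
    (μZ : Measure diagZ) [μZ.IsHaarMeasure] [IsProbabilityMeasure μZ]
    (μK : Measure antiK) [μK.IsHaarMeasure] [IsProbabilityMeasure μK]
    (Φ : Matrix (Fin 2) (Fin 2) ℂ → ℂ) (hΦc : Continuous Φ)
    (hΦ : ∀ (c : ℂ) (M : Matrix (Fin 2) (Fin 2) ℂ), ‖c‖ = 1 → Φ (c • M) = Φ M) :
    ∫ t, Φ (diagMat t) ∂ν = ∫ k : antiK, Φ (diagMat k) ∂μK :=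
  integral_eq_integral_antiK ν μZ μK (fun t => Φ (diagMat t)) (hΦc.comp continuous_diagMat)
    (invariant_of_matrix Φ hΦ)

end Summit.Ventures.HodgeRepro2.Tier7.Line3.TorusMatrixLink
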